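import Mathlib.Analysis.SpecialFunctions.Pow.Deriv
import Mathlib.Analysis.SpecialFunctions.Pow.Continuity
import Literature.NumberTheory.Transcendental.KZCalculusProofs

/-!
# `CompleteModGammaSector` (stmt-KontsevichZagierPeriods-14233), line `cusp-transport-to-the-beta-world`:
# stub `stub_elliottPotentialU` — fibre regularity of the potential Q along u

Support file (`--supports stmt-KontsevichZagierPeriods-14233`) for the registered stub `stub_elliottPotentialU` of the line lead's
skeleton `Cruxes/CompleteModGammaSector/Lines/cusp-transport-to-the-beta-world.lean`. Notation (functions of
`z : Fin 3 → ℝ`, `t = z 0`, `u = z 1`, `s = z 2`; rational `0 < a < 1`, `1 - a < c`; real algebraic modulus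
`z₁ ∈ (0,1)`): family `F = t^{-a}(1-t)^{c+a-2}(1-st)^{-a} · u^{-a}(1-u)^{c+a-2}(1-(1-s)u)^{-a} · (1 - st - (1-s)u)`
(Elliott–Legendre combination in Euler form, AQVV 2000 Cor. 3.13 (5); `a = 1/2`, `c = 1` is Legendre's relation),
potentials `P = t^{1-a}(1-t)^{c+a-1}(1-st)^{-a} · u^{1-a}(1-u)^{c+a-2}(1-(1-s)u)^{-a}`,
`Q = -t^{1-a}(1-t)^{c+a-2}(1-st)^{-a} · u^{1-a}(1-u)^{c+a-1}(1-(1-s)u)^{-a}`, certificate `∂_sF = ∂_tP + ∂_uQ`.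

References: M. Kontsevich, D. Zagier, *Periods* (2001), §1.2; G. D. Anderson, S.-L. Qiu, M. K. Vamanamurthy,
M. Vuorinen, *Generalized elliptic integrals and modular equations*, Pacific J. Math. 192 (2000), Cor. 3.13 (5);
G. E. Andrews, R. Askey, R. Roy, *Special Functions* (1999), Thm 3.2.8.
-/

noncomputable section

-- `Summit.KontsevichZagierPeriods.KontsevichZagierPeriods.…` is the tree's mandated layout (single-conjunct summit).
set_option linter.dupNamespace false

namespace Summit.KontsevichZagierPeriods.KontsevichZagierPeriods.CompleteModGammaSectorCuspLine

open MeasureTheory Set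
open Literature.NumberTheory.Transcendental

/-- Reading the updated `u`-coordinate `Fin.castSucc (1 : Fin 2) = 1` of `Fin 3` returns the new value. -/
private theorem update_u_apply_one (z : Fin 3 → ℝ) (v : ℝ) :
    Function.update z (Fin.castSucc (1 : Fin 2)) v 1 = v :=
  Function.update_self _ v z

/-- Updating the `u`-coordinate does not change the `t`-coordinate `0`. -/
private theorem update_u_apply_zero (z : Fin 3 → ℝ) (v : ℝ) :
    Function.update z (Fin.castSucc (1 : Fin 2)) v 0 = z 0 :=
  Function.update_of_ne (by decide) v z

/-- Updating the `u`-coordinate does not change the `s`-coordinate `2`. -/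
private theorem update_u_apply_two (z : Fin 3 → ℝ) (v : ℝ) :
    Function.update z (Fin.castSucc (1 : Fin 2)) v 2 = z 2 :=
  Function.update_of_ne (by decide) v z

/-- Stub `stub_elliottPotentialU` of line `cusp-transport-to-the-beta-world` (fibre regularity of the potential Q along u). [cite: KontsevichZagier2001, §1.2] -/
theorem stub_elliottPotentialU : ∀ (a c : ℚ) (z₁ : ℝ), 0 < a → a < 1 → 1 - a < c → 0 < z₁ → z₁ < 1 → IsAlgebraic ℚ z₁ →
    ∀ z : Fin 3 → ℝ, ((∀ j : Fin 2, z (Fin.castSucc j) ∈ Set.Ioo (0:ℝ) 1) ∧ z (Fin.last 2) ∈ Set.Ioo (0:ℝ) z₁) →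
      ContinuousOn (fun v : ℝ => (fun z : Fin 3 → ℝ => -((z 0) ^ (1 - (a : ℝ)) * (1 - z 0) ^ ((c : ℝ) + (a : ℝ) - 2) * (1 - z 2 * z 0) ^ (-(a : ℝ)) * ((z 1) ^ (1 - (a : ℝ)) * (1 - z 1) ^ ((c : ℝ) + (a : ℝ) - 1) * (1 - (1 - z 2) * z 1) ^ (-(a : ℝ))))) (Function.update z (Fin.castSucc (1 : Fin 2)) v)) (Set.Icc (0:ℝ) 1) ∧
      (fun z : Fin 3 → ℝ => -((z 0) ^ (1 - (a : ℝ)) * (1 - z 0) ^ ((c : ℝ) + (a : ℝ) - 2) * (1 - z 2 * z 0) ^ (-(a : ℝ)) * ((z 1) ^ (1 - (a : ℝ)) * (1 - z 1) ^ ((c : ℝ) + (a : ℝ) - 1) * (1 - (1 - z 2) * z 1) ^ (-(a : ℝ))))) (Function.update z (Fin.castSucc (1 : Fin 2)) 0) = 0 ∧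
      (fun z : Fin 3 → ℝ => -((z 0) ^ (1 - (a : ℝ)) * (1 - z 0) ^ ((c : ℝ) + (a : ℝ) - 2) * (1 - z 2 * z 0) ^ (-(a : ℝ)) * ((z 1) ^ (1 - (a : ℝ)) * (1 - z 1) ^ ((c : ℝ) + (a : ℝ) - 1) * (1 - (1 - z 2) * z 1) ^ (-(a : ℝ))))) (Function.update z (Fin.castSucc (1 : Fin 2)) 1) = 0 ∧
      ∀ v ∈ Set.Ioo (0:ℝ) 1, HasDerivAt (fun w : ℝ => (fun z : Fin 3 → ℝ => -((z 0) ^ (1 - (a : ℝ)) * (1 - z 0) ^ ((c : ℝ) + (a : ℝ) - 2) * (1 - z 2 * z 0) ^ (-(a : ℝ)) * ((z 1) ^ (1 - (a : ℝ)) * (1 - z 1) ^ ((c : ℝ) + (a : ℝ) - 1) * (1 - (1 - z 2) * z 1) ^ (-(a : ℝ))))) (Function.update z (Fin.castSucc (1 : Fin 2)) w))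
        ((fun z : Fin 3 → ℝ => -((z 0) ^ (1 - (a : ℝ)) * (1 - z 0) ^ ((c : ℝ) + (a : ℝ) - 2) * (1 - z 2 * z 0) ^ (-(a : ℝ)) * ((z 1) ^ (-(a : ℝ)) * (1 - z 1) ^ ((c : ℝ) + (a : ℝ) - 2) * (1 - (1 - z 2) * z 1) ^ (-(a : ℝ) - 1) * ((1 - (a : ℝ)) * (1 - z 1) * (1 - (1 - z 2) * z 1) - ((c : ℝ) + (a : ℝ) - 1) * z 1 * (1 - (1 - z 2) * z 1) + (a : ℝ) * (1 - z 2) * z 1 * (1 - z 1))))) (Function.update z (Fin.castSucc (1 : Fin 2)) v)) v := by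
  intro a c z₁ _ ha1 hc _ hz₁1 _ z hz
  -- real versions of the parameter inequalities
  have ha1' : (a : ℝ) < 1 := by exact_mod_cast ha1
  have hc' : 1 - (a : ℝ) < c := by exact_mod_cast hc
  have h1a : (0 : ℝ) < 1 - a := sub_pos.mpr ha1'
  have hca : (0 : ℝ) < c + a - 1 := by linarith
  -- the parameter `s = z 2` lies in `(0,1)`
  have hs : z 2 ∈ Set.Ioo (0 : ℝ) z₁ := hz.2
  have hs1 : z 2 < 1 := hs.2.trans hz₁1
  -- the base `1 - (1 - s) v` is positive on `[0,1]`
  have hbase : ∀ v : ℝ, 0 ≤ v → v ≤ 1 → 0 < 1 - (1 - z 2) * v := by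
    intro v _ hv1
    have : (1 - z 2) * v ≤ (1 - z 2) * 1 := mul_le_mul_of_nonneg_left hv1 (by linarith)
    linarith [hs.1]
  simp only [update_u_apply_one, update_u_apply_zero, update_u_apply_two]
  -- the `t`-factor is a constant along the fibre
  generalize z 0 ^ (1 - (a : ℝ)) * (1 - z 0) ^ ((c : ℝ) + (a : ℝ) - 2) * (1 - z 2 * z 0) ^ (-(a : ℝ)) = K
  refine ⟨?_, ?_, ?_, ?_⟩
  · -- continuity on `[0,1]`
    have c1 : ContinuousOn (fun v : ℝ => v ^ (1 - (a : ℝ))) (Icc 0 1) :=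
      (Real.continuous_rpow_const h1a.le).continuousOn
    have c2 : ContinuousOn (fun v : ℝ => (1 - v) ^ ((c : ℝ) + (a : ℝ) - 1)) (Icc 0 1) :=
      ContinuousOn.rpow_const (by fun_prop) fun x _ => Or.inr hca.le
    have c3 : ContinuousOn (fun v : ℝ => (1 - (1 - z 2) * v) ^ (-(a : ℝ))) (Icc 0 1) :=
      ContinuousOn.rpow_const (by fun_prop) fun x hx => Or.inl (hbase x hx.1 hx.2).ne'
    exact (continuousOn_const.fun_mul ((c1.fun_mul c2).fun_mul c3)).fun_neg
  · -- value at `v = 0`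
    rw [Real.zero_rpow h1a.ne']
    ring
  · -- value at `v = 1`
    rw [sub_self, Real.zero_rpow hca.ne']
    ring
  · -- derivative at `v ∈ (0,1)`
    intro v hv
    obtain ⟨hv0, hv1⟩ := hv
    have h1v : (0 : ℝ) < 1 - v := sub_pos.mpr hv1
    have hb : 0 < 1 - (1 - z 2) * v := hbase v hv0.le hv1.le
    have h1 : HasDerivAt (fun w : ℝ => w ^ (1 - (a : ℝ)))
        (1 * (1 - (a : ℝ)) * v ^ (1 - (a : ℝ) - 1)) v :=
      (hasDerivAt_id' v).rpow_const (Or.inl hv0.ne')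
    have h2 : HasDerivAt (fun w : ℝ => (1 - w) ^ ((c : ℝ) + (a : ℝ) - 1))
        (-1 * ((c : ℝ) + (a : ℝ) - 1) * (1 - v) ^ ((c : ℝ) + (a : ℝ) - 1 - 1)) v :=
      ((hasDerivAt_id' v).const_sub 1).rpow_const (Or.inl h1v.ne')
    have h3 : HasDerivAt (fun w : ℝ => (1 - (1 - z 2) * w) ^ (-(a : ℝ)))
        (-((1 - z 2) * 1) * (-(a : ℝ)) * (1 - (1 - z 2) * v) ^ (-(a : ℝ) - 1)) v :=
      (((hasDerivAt_id' v).const_mul (1 - z 2)).const_sub 1).rpow_const (Or.inl hb.ne')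
    have h := (((h1.fun_mul h2).fun_mul h3).const_mul K).fun_neg
    refine h.congr_deriv ?_
    -- exponent bookkeeping and splitting one power off each base
    have e1 : v ^ (1 - (a : ℝ) - 1) = v ^ (-(a : ℝ)) := by
      congr 1; ring
    have e2 : (1 - v) ^ ((c : ℝ) + (a : ℝ) - 1 - 1) = (1 - v) ^ ((c : ℝ) + (a : ℝ) - 2) := by
      congr 1; ring
    have s1 : v ^ (1 - (a : ℝ)) = v ^ (-(a : ℝ)) * v := by
      rw [← Real.rpow_add_one hv0.ne']; congr 1; ring
    have s2 : (1 - v) ^ ((c : ℝ) + (a : ℝ) - 1) = (1 - v) ^ ((c : ℝ) + (a : ℝ) - 2) * (1 - v) := by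
      rw [← Real.rpow_add_one h1v.ne']; congr 1; ring
    have s3 : (1 - (1 - z 2) * v) ^ (-(a : ℝ)) =
        (1 - (1 - z 2) * v) ^ (-(a : ℝ) - 1) * (1 - (1 - z 2) * v) := by
      rw [← Real.rpow_add_one hb.ne']; congr 1; ring
    rw [e1, e2, s1, s2, s3]
    ring

end Summit.KontsevichZagierPeriods.KontsevichZagierPeriods.CompleteModGammaSectorCuspLine
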